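/-
Origin: expansion seat `planner-pub-hodgecm-pv03-g5-0`, handover #1 2026-08-18T08:36:26Z (`HOME/pub-hodgecm-pv03-g5/lean/Pv03g5/ThetaUiso.lean`, md5 48b68c2b, 654 lines);
landed by the gen-7 packager in gate run 27 as `HodgeCM/Model/ToyG2/ThetaUiso.lean` (verbatim).
-/
/-
# HodgeCM.Model.ToyG2.ThetaUiso — single eigenvectors of the period leaf are isotypic theta classes

pub-hodgecm cell, seat `planner-pub-hodgecm-pv03-g5-0` (DAG-node prover #03, generation 5), 2026-08-18.
Item (R2-a) of `pub-hodgecm-toy-g2/DESIGN.md` §8 ("Theta vectors, Uiso") for the generation-2 toy universes on the period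
leaves — `toyUniverse₂ d t` (`HodgeCM.Model.ToyG2.PeriodLeaf`) and the GOOD-object universe `toyUniverse₃ d t`
(`HodgeCM.Model.ToyG2.Universe3`, the live candidate model) — whose period surface at `(L, ι₁)` is the block object on the
period leaf `P(L, ι₁) = ∏_{q ∈ Q(L,ι₁)} M_{Θ_q}`, `M_Θ = A_{(L,Θ₀)} × ⋯ × A_{(L,Θ₃)}`.

CONTENT (linear algebra only — no analytic side, and no `ThetaModel` structure, which stays with the model's owner):

* §1 `extC_eps_eq_sum` — the EXACT eigen-decomposition along a field embedding `m : F →+* F'`: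
  `(ℂ ⊗ m)(eps_F τ) = Σ_{τ' ∘ m = τ} eps_{F'} τ'`, its `x`-twist `(1 ⊗ x)·(ℂ ⊗ m)(eps_F τ) = Σ_{τ' ∘ m = τ} τ'(x) eps τ'`,
  and the DUAL-BASIS INVERSION `Σ_n τ₀(d_n) • ((1 ⊗ b_n)·(ℂ ⊗ m)(eps_F τ)) = eps_{F'} τ₀` for `τ₀ ∘ m = τ`
  (`d, b` the trace-dual bases of `HodgeCM.Model.Toy.CMIdempotent`; duality `ToyG2.EigenForms.sum_emb_dF_mul_emb_bF`).
* §2 `indType j Φ` — the CM type of `L` INDUCED from a CM type `Φ` of `K` along `j : K →+* L` (`θ ∈ indType j Φ ↔ θ ∘ j ∈ Φ`);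
  the pair-sum identity is inherited, so a pair-sum quadruple `Ψ` over `K` all of whose members contain `σ = ι₁ ∘ j`
  induces an admissible index `qInd ∈ Q(L, ι₁)` (`ToyG2.PeriodLeaf.QIdx`), with `ΘOf (eQ qInd) i = indType j (Ψ i)`.
* §3 the slot maps `a ↦ x · j(a)` into slot `i` of `M_Θ` (`slotLin`) — Hodge as soon as `Θ i = indType j Ψ` (`slotLin_isHodge`).
* §4 (universe-free core, over generation-1 objects and `Hom₂`) the slot morphisms `m_{k,i,x} : P(L,ι₁) → A_{(K,Ψ)}`
  (`leafMor`; admissible because the target is block-free, `Obj₂.Hom₂.ofHom`, exactly as `ToyG2.InputsWitness.morAt`); the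
  SINGLE eigenvector `E_{k,i,τ'} = eCls k i τ'` (`eps τ'` in slot `i` of block `k`, as a degree-one class); the PULL-BACK
  FORMULA `(⋀¹ m_{k,i,x})_ℂ (gen_σ) = Σ_{τ' ∘ j = σ} τ'(x) • E_{k,i,τ'}` (`map_leafLin_gen`); the dual-basis inversion
  `E_{k,i,τ₀} = Σ_n τ₀(d_n) • (⋀¹ m_{k,i,b_n})_ℂ (gen_σ)` for `τ₀` over `σ` (`eCls_eq_sum_map_leafLin_gen`); and
  `E ∧ E' ≠ 0` for two distinct single eigenvectors (`wedge_eCls_ne_zero`, a 2×2 coordinate minor `ιMulti_eVec_ne_zero`).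
* §5₂ / §5₃ the universe-level statements for `U = toyUniverse₂ d t` / `toyUniverse₃ d t` (proofs = the core by `rfl`-transport):
  `pullC_leafMor_gen`, **single eigenvectors are isotypic** `E_{k,i,τ₀} ∈ U.Uiso Γ K Ψ σ` for every `τ₀` over `σ ∈ Ψ`
  (`eCls_mem_uiso₂/₃` — the "use single eigenvectors" line of DESIGN.md §5 made kernel), `U.cup2C … E E' ≠ 0`
  (`cup_eCls_ne_zero₂/₃`), and, for the candidate theta sets `thetaSet₂/₃` (`E_{qInd(j),i,ι₁}` over the `j` with `ι₁ ∘ j = σ`),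
  `thetaSet ⊆ U_iso` (`thetaSet_sub_uiso₂/₃`) and the wedge non-vanishing (`thetaSet_wedge₂/₃`), i.e. the two `ThetaModel.Inputs`
  fields that only see `H¹` — `Open_thetaSub` / `Open_thetaWedge` — for ANY theta model on `U` with these theta sets
  (`open_thetaSub_of_theta_eq₂/₃`, `open_thetaWedge_of_theta_eq₂/₃`).

No placeholders, no new axioms, nothing cited; imports `HodgeCM.Model.ToyG2.{PeriodLeaf, EigenForms, Universe3}` (toy-g2, run 26)
and `HodgeCM.Model.ToyG2.InputsWitness` (pv03-g4, run 26; for `extC`, `jT`, `ιMulti_two_ne_zero`).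
-/
import Mathlib
import Summits.HodgeConjecture.HodgeCM.Model.ToyG2.PeriodLeaf
import Summits.HodgeConjecture.HodgeCM.Model.ToyG2.EigenForms_2
import Summits.HodgeConjecture.HodgeCM.Model.ToyG2.Universe3
import Summits.HodgeConjecture.HodgeCM.Model.ToyG2.InputsWitness_2

namespace HodgeCM.ToyG2.ThetaUiso

open HodgeCM.Toy HodgeCM.Toy.CMPresentation HodgeCM.ToyG2 HodgeCM.ToyG2.Obj₂
open HodgeCM.ToyG2.InputsWitness (extC extC_tmul extC_eq_baseChange extC_eps_eigen extC_injective jT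
  ιMulti_two_ne_zero)
open Literature.AlgebraicGeometry.Motives
open scoped TensorProduct
open exteriorPower

noncomputable section

/-! ### 1. Exact eigen-decomposition along a field embedding -/

section Ext

variable {F F' : Type*} [Field F] [NumberField F] [Field F'] [NumberField F'] (m : F →+* F')

omit [NumberField F] in
/-- `(z ⊗ y) · eps τ' = (z τ'(y)) • eps τ'` -/
lemma tmul_mul_eps' (τ' : F' →+* ℂ) (z : ℂ) (y : F') :
    (z ⊗ₜ[ℚ] y) * eps F' τ' = (z * τ' y) • eps F' τ' := by
  have h : z ⊗ₜ[ℚ] y = z • ((1 : ℂ) ⊗ₜ[ℚ] y) := by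
    rw [TensorProduct.smul_tmul', smul_eq_mul, mul_one]
  rw [h, smul_mul_assoc, tmul_mul_eps, smul_smul]

/-- over an embedding `τ'` of `F'` extending `τ`, `(ℂ ⊗ m)(eps_F τ)` acts as the identity on `eps_{F'} τ'` -/
lemma extC_eps_mul_eps_of_comp_eq {τ : F →+* ℂ} {τ' : F' →+* ℂ} (h : τ'.comp m = τ) :
    extC m (eps F τ) * eps F' τ' = eps F' τ' := by
  classical
  have hexp : extC m (eps F τ) = ∑ i, τ (dF F i) ⊗ₜ[ℚ] m (bF F i) := by
    simp only [eps, map_sum, extC_tmul]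
  rw [hexp, Finset.sum_mul]
  simp_rw [tmul_mul_eps', ← Finset.sum_smul]
  have h1 : ∑ i, τ (dF F i) * τ' (m (bF F i)) = 1 := by
    have h2 := sum_emb_dF_mul_emb_bF F τ τ
    rw [if_pos rfl] at h2
    rw [← h2]
    refine Finset.sum_congr rfl fun i _ => ?_
    rw [← RingHom.comp_apply τ' m, h]
  rw [h1, one_smul]

/-- over an embedding `τ'` of `F'` NOT extending `τ`, `(ℂ ⊗ m)(eps_F τ)` kills `eps_{F'} τ'` -/
lemma extC_eps_mul_eps_of_comp_ne {τ : F →+* ℂ} {τ' : F' →+* ℂ} (h : τ'.comp m ≠ τ) :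
    extC m (eps F τ) * eps F' τ' = 0 := by
  obtain ⟨k, hk⟩ := exists_apply_ne_of_ne h
  exact mul_eps_eq_zero_of_eigen (extC_eps_eigen m τ k)
    (fun h' => hk (by rw [RingHom.comp_apply]; exact h'.symm))

open scoped Classical in
/-- **exact eigen-decomposition along a field embedding**: `(ℂ ⊗ m)(eps_F τ) = Σ_{τ' ∘ m = τ} eps_{F'} τ'` -/
theorem extC_eps_eq_sum (τ : F →+* ℂ) :
    extC m (eps F τ) = ∑ τ' ∈ Finset.univ.filter (fun τ' : F' →+* ℂ => τ'.comp m = τ), eps F' τ' := by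
  classical
  have hx : extC m (eps F τ) = ∑ τ' : F' →+* ℂ, extC m (eps F τ) * eps F' τ' := by
    rw [← Finset.mul_sum, sum_eps, mul_one]
  rw [hx, Finset.sum_filter]
  refine Finset.sum_congr rfl fun τ' _ => ?_
  split_ifs with h
  · exact extC_eps_mul_eps_of_comp_eq m h
  · exact extC_eps_mul_eps_of_comp_ne m h

open scoped Classical in
/-- the `x`-twisted decomposition `(1 ⊗ x) · (ℂ ⊗ m)(eps_F τ) = Σ_{τ' ∘ m = τ} τ'(x) • eps_{F'} τ'` -/
theorem tmul_mul_extC_eps (τ : F →+* ℂ) (x : F') :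
    (1 ⊗ₜ[ℚ] x) * extC m (eps F τ)
      = ∑ τ' ∈ Finset.univ.filter (fun τ' : F' →+* ℂ => τ'.comp m = τ), τ' x • eps F' τ' := by
  rw [extC_eps_eq_sum, Finset.mul_sum]
  exact Finset.sum_congr rfl fun τ' _ => tmul_mul_eps τ' x

/-- **dual-basis inversion**: for `τ₀` over `τ`, `Σ_n τ₀(d_n) • ((1 ⊗ b_n) · (ℂ ⊗ m)(eps_F τ)) = eps_{F'} τ₀` -/
theorem sum_dF_smul_bF_mul_extC_eps {τ : F →+* ℂ} {τ₀ : F' →+* ℂ} (h : τ₀.comp m = τ) :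
    ∑ n, τ₀ (dF F' n) • ((1 ⊗ₜ[ℚ] bF F' n) * extC m (eps F τ)) = eps F' τ₀ := by
  classical
  simp_rw [tmul_mul_extC_eps, Finset.smul_sum, smul_smul]
  rw [Finset.sum_comm]
  simp_rw [← Finset.sum_smul, sum_emb_dF_mul_emb_bF, ite_smul, one_smul, zero_smul, Finset.sum_ite_eq']
  exact if_pos (by simpa only [Finset.mem_filter, Finset.mem_univ, true_and] using h)

end Ext

/-! ### 2. Induced CM types and the induced admissible index -/

section Ind

variable {K L : CMField}

/-- the CM type of `L` **induced** from the CM type `Φ` of `K` along `j : K →+* L`: the embeddings of `L` whose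
restriction along `j` lies in `Φ` -/
def indType (j : K →+* L) (Φ : CMType K) : CMType L :=
  ⟨{θ | θ.comp j ∈ Φ.1}, fun θ => by
    have hc : (NumberField.ComplexEmbedding.conjugate θ).comp j
        = NumberField.ComplexEmbedding.conjugate (θ.comp j) := by
      ext x
      simp [NumberField.ComplexEmbedding.conjugate_coe_eq]
    show θ.comp j ∈ Φ.1 ↔ (NumberField.ComplexEmbedding.conjugate θ).comp j ∉ Φ.1
    rw [hc]
    exact Φ.2 _⟩

/-- (Ported verbatim from the HodgeCMPerL package; no docstring in the source.) -/
@[simp] lemma mem_indType_iff (j : K →+* L) (Φ : CMType K) (θ : L →+* ℂ) :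
    θ ∈ (indType j Φ).1 ↔ θ.comp j ∈ Φ.1 := Iff.rfl

/-- (Ported verbatim from the HodgeCMPerL package; no docstring in the source.) -/
lemma ind_indType (j : K →+* L) (Φ : CMType K) (θ : L →+* ℂ) :
    ind (indType j Φ) θ = ind Φ (θ.comp j) := by
  unfold ind
  by_cases h : θ.comp j ∈ Φ.1
  · rw [if_pos h, if_pos ((mem_indType_iff j Φ θ).mpr h)]
  · rw [if_neg h, if_neg (fun h' => h ((mem_indType_iff j Φ θ).mp h'))]

/-- the pair-sum identity is inherited by the induced quadruple -/
lemma pairSum_indType (j : K →+* L) {Ψ : Fin 4 → CMType K} (h : PairSum Ψ) :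
    PairSum fun i => indType j (Ψ i) := fun θ => by
  simpa only [ind_indType] using h (θ.comp j)

variable (ι₁ : L →+* ℂ)

/-- **the induced admissible index** `qInd ∈ Q(L, ι₁)`: the quadruple `(indType j Ψᵢ)ᵢ` of a pair-sum quadruple `Ψ`
over `K` all of whose members contain `ι₁ ∘ j` -/
def qInd (j : K →+* L) (Ψ : Fin 4 → CMType K) (hP : PairSum Ψ) (hm : ∀ i, ι₁.comp j ∈ (Ψ i).1) :
    QIdx L ι₁ :=
  ⟨fun i => indType j (Ψ i), pairSum_indType j hP, hm⟩

/-- (Ported verbatim from the HodgeCMPerL package; no docstring in the source.) -/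
@[simp] lemma ΘOf_eQ_qInd (j : K →+* L) (Ψ : Fin 4 → CMType K) (hP : PairSum Ψ)
    (hm : ∀ i, ι₁.comp j ∈ (Ψ i).1) (i : Fin 4) :
    ΘOf L ι₁ (eQ L ι₁ (qInd ι₁ j Ψ hP hm)) i = indType j (Ψ i) := by
  simp [ΘOf, qInd]

/-! The presentations `FK K`, `FK L` (`HodgeCM.Model.Toy.Model`): `jT j = eK_L ∘ j ∘ eK_K⁻¹`. -/

/-- (Ported verbatim from the HodgeCMPerL package; no docstring in the source.) -/
lemma jT_comp_eK (j : K →+* L) : (jT j).comp (eK K : K →+* FK K) = (eK L : L →+* FK L).comp j := by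
  ext x
  simp [jT]

/-- `τ'` lies over a `Ψ`-holomorphic embedding of `FK K` iff `τ'` is `indType j Ψ`-holomorphic -/
lemma comp_jT_mem_iff (j : K →+* L) (Ψ : CMType K) (τ' : FK L →+* ℂ) :
    τ'.comp (jT j) ∈ (atomOf K Ψ).Φ ↔ τ'.comp (eK L : L →+* FK L) ∈ (indType j Ψ).1 := by
  rw [mem_atomΦ_iff, mem_indType_iff, RingHom.comp_assoc, jT_comp_eK, ← RingHom.comp_assoc]

/-- the transported `ι₁` lies over the transported `ι₁ ∘ j` -/
lemma embOf_comp_jT (j : K →+* L) : (embOf L ι₁).comp (jT j) = embOf K (ι₁.comp j) := by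
  ext x
  simp [embOf, jT]

end Ind

/-! ### 3. The slot morphisms `P(L, ι₁) → A_{(K,Ψ)}` -/

section Slot

variable {K L : CMField} (Θ : Fin 4 → CMType L) (j : K →+* L) (Ψ : CMType K)

/-- `a ↦ x · j(a)`, a `ℚ`-linear map `FK K → FK L` -/
def mulJ (x : FK L) : FK K →ₗ[ℚ] FK L :=
  LinearMap.mulLeft ℚ x ∘ₗ (jT j).toRatAlgHom.toLinearMap

/-- (Ported verbatim from the HodgeCMPerL package; no docstring in the source.) -/
lemma mulJ_baseChange (x : FK L) (y : ℂ ⊗[ℚ] FK K) :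
    (mulJ j x).baseChange ℂ y = (1 ⊗ₜ[ℚ] x) * extC (jT j) y := by
  rw [mulJ, LinearMap.baseChange_comp, LinearMap.comp_apply, ← extC_eq_baseChange, baseChange_mulLeft]

/-- the lattice map of the slot morphism: `L(A_{(K,Ψ)}) → L(M_Θ)`, `a ↦ x · j(a)` placed in slot `i` -/
def slotLin (i : Fin 4) (x : FK L) : (cmObj K Ψ).L →ₗ[ℚ] (PP L Θ).L :=
  emb L Θ i ∘ₗ mulJ j x ∘ₗ LinearMap.proj (R := ℚ) (φ := fun _ : Unit => (FK K : Type)) ()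

/-- the slot inclusion on eigenvectors: `(emb_i)_ℂ (eps τ') = e_{(i, τ')}` -/
lemma emb_baseChange_eps (i : Fin 4) (τ' : FK L →+* ℂ) :
    (emb L Θ i).baseChange ℂ (eps (FK L) τ') = (PP L Θ).eB (ix L Θ τ' i) := by
  fin_cases i <;> exact ((PP L Θ).eB_apply _ _).symm

/-- (Ported verbatim from the HodgeCMPerL package; no docstring in the source.) -/
lemma slotLin_baseChange_eT (i : Fin 4) (x : FK L) (τ : FK K →+* ℂ) :
    (slotLin Θ j Ψ i x).baseChange ℂ ((cmObj K Ψ).eT () τ)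
      = (emb L Θ i).baseChange ℂ ((1 ⊗ₜ[ℚ] x) * extC (jT j) (eps (FK K) τ)) := by
  change ((slotLin Θ j Ψ i x).baseChange ℂ ∘ₗ
      (LinearMap.single ℚ (fun _ : Unit => (FK K : Type)) ()).baseChange ℂ) (eps (FK K) τ) = _
  have hc : slotLin Θ j Ψ i x ∘ₗ LinearMap.single ℚ (fun _ : Unit => (FK K : Type)) ()
      = emb L Θ i ∘ₗ mulJ j x := by
    rw [slotLin, LinearMap.comp_assoc, LinearMap.comp_assoc, LinearMap.proj_comp_single_same,
      LinearMap.comp_id]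
  rw [← LinearMap.baseChange_comp, hc, LinearMap.baseChange_comp, LinearMap.comp_apply, mulJ_baseChange]

open scoped Classical in
/-- **the image of a `K`-eigenvector**: `(slotLin)_ℂ (e_τ) = Σ_{τ' ∘ j = τ} τ'(x) • e_{(i, τ')}` -/
theorem slotLin_baseChange_eT_eq_sum (i : Fin 4) (x : FK L) (τ : FK K →+* ℂ) :
    (slotLin Θ j Ψ i x).baseChange ℂ ((cmObj K Ψ).eT () τ)
      = ∑ τ' ∈ Finset.univ.filter (fun τ' : FK L →+* ℂ => τ'.comp (jT j) = τ),
          τ' x • (PP L Θ).eB (ix L Θ τ' i) := by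
  rw [slotLin_baseChange_eT, tmul_mul_extC_eps, map_sum]
  refine Finset.sum_congr rfl fun τ' _ => ?_
  rw [map_smul, emb_baseChange_eps]

/-- the slot map is a Hodge map as soon as slot `i` carries the induced type -/
theorem slotLin_isHodge (i : Fin 4) (x : FK L) (hΘ : Θ i = indType j Ψ) :
    Obj.IsHodge (slotLin Θ j Ψ i x) := by
  classical
  rw [Obj.isHodge_iff]
  rintro ⟨⟩ τ hτ
  rw [slotLin_baseChange_eT_eq_sum]
  refine Submodule.sum_mem _ fun τ' hτ' => Submodule.smul_mem _ _ (Obj.eB_mem_F1 _ ?_)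
  obtain ⟨-, h'⟩ := Finset.mem_filter.mp hτ'
  rw [hol_ix, hΘ, ← comp_jT_mem_iff, h']
  exact hτ

end Slot

/-! ### 4. Through the period leaf: single eigenvectors, the pull-back formula, isotypy -/

/-- the extension by zero `L(B_k) → L(∏ B)` is a Hodge map -/
theorem isHodge_inclFam : ∀ (m : ℕ) (B : Fin m → Obj) (k : Fin m),
    Obj.IsHodge (X := prodFam m B) (Y := B k) (inclFam m B k)
  | 0, _, k => k.elim0
  | m + 1, B, k => by
    refine Fin.cases (motive := fun k => Obj.IsHodge (X := prodFam (m + 1) B) (Y := B k)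
      (inclFam (m + 1) B k)) ?_ ?_ k
    · rw [inclFam_zero]
      exact Obj.isHodge_inlL
    · intro k'
      rw [inclFam_succ]
      exact Obj.isHodge_inrL.comp (isHodge_inclFam m (fun k => B k.succ) k')

/-- `Θ₂ (form1 a ∪ form1 b) = a ∧ b` for vectors `a, b ∈ ℂ ⊗ L X` (the degree-two case of `Obj.theta_quad`) -/
lemma theta_pair (X : Obj) (a b : X.LC) :
    X.Θ 2 (LinearMap.BilinMap.baseChange ℂ (wedge ℚ X.L 1 1) (X.form1 a) (X.form1 b)) = ιMulti ℂ 2 ![a, b] := by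
  simp only [Obj.theta_cup2_one, Obj.theta_form1]
  apply Subtype.ext
  simp only [wedge_coe, ιMulti_apply_coe, ExteriorAlgebra.ιMulti_apply]
  simp [List.ofFn_succ]

section Leaf

variable {L : CMField} (ι₁ : L →+* ℂ) (d t : ℚ)

/-- the gen-1 object `∏_q M_{Θ_q}` of the period leaf `P(L, ι₁)` (`= (pbObj (pLeafOf L ι₁ d t)).toObj` by `rfl`) -/
abbrev PO : Obj := (pLeafOf L ι₁ d t).O

variable (k : Fin (nQ L ι₁))

/-- the inclusion of block `k`: `L(M_{Θ_k}) → L(P(L, ι₁))` (`ToyG2.PeriodLeaf.inclFam` at the types of the leaf) -/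
def leafIncl : (PP L (ΘOf L ι₁ k)).L →ₗ[ℚ] (PO ι₁ d t).L := inclFam (nQ L ι₁) (blockFam L ι₁) k

/-- the restriction to block `k`: `L(P(L, ι₁)) → L(M_{Θ_k})` (`ToyG2.PeriodLeaf.projFam`) -/
def leafProj : (PO ι₁ d t).L →ₗ[ℚ] (PP L (ΘOf L ι₁ k)).L := projFam (nQ L ι₁) (blockFam L ι₁) k

/-- (Ported verbatim from the HodgeCMPerL package; no docstring in the source.) -/
lemma leafProj_leafIncl_self (u : (PP L (ΘOf L ι₁ k)).L) :
    leafProj ι₁ d t k (leafIncl ι₁ d t k u) = u :=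
  projFam_inclFam_self (nQ L ι₁) (blockFam L ι₁) k u

/-- (Ported verbatim from the HodgeCMPerL package; no docstring in the source.) -/
lemma leafProj_leafIncl_of_ne {k k' : Fin (nQ L ι₁)} (h : k' ≠ k) (u : (PP L (ΘOf L ι₁ k)).L) :
    leafProj ι₁ d t k' (leafIncl ι₁ d t k u) = 0 :=
  projFam_inclFam_of_ne (nQ L ι₁) (blockFam L ι₁) k k' h u

/-- (Ported verbatim from the HodgeCMPerL package; no docstring in the source.) -/
lemma isHodge_leafIncl : Obj.IsHodge (X := PO ι₁ d t) (Y := PP L (ΘOf L ι₁ k)) (leafIncl ι₁ d t k) :=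
  isHodge_inclFam (nQ L ι₁) (blockFam L ι₁) k

/-- (Ported verbatim from the HodgeCMPerL package; no docstring in the source.) -/
lemma leafProj_baseChange_leafIncl_self (y : (PP L (ΘOf L ι₁ k)).LC) :
    (leafProj ι₁ d t k).baseChange ℂ ((leafIncl ι₁ d t k).baseChange ℂ y) = y := by
  have hc : leafProj ι₁ d t k ∘ₗ leafIncl ι₁ d t k = LinearMap.id :=
    LinearMap.ext fun u => leafProj_leafIncl_self ι₁ d t k u
  rw [← LinearMap.comp_apply, ← LinearMap.baseChange_comp, hc, LinearMap.baseChange_id, LinearMap.id_apply]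

/-- (Ported verbatim from the HodgeCMPerL package; no docstring in the source.) -/
lemma leafProj_baseChange_leafIncl_of_ne {k k' : Fin (nQ L ι₁)} (h : k' ≠ k) (y : (PP L (ΘOf L ι₁ k)).LC) :
    (leafProj ι₁ d t k').baseChange ℂ ((leafIncl ι₁ d t k).baseChange ℂ y) = 0 := by
  have hc : leafProj ι₁ d t k' ∘ₗ leafIncl ι₁ d t k = 0 :=
    LinearMap.ext fun u => leafProj_leafIncl_of_ne ι₁ d t h u
  rw [← LinearMap.comp_apply, ← LinearMap.baseChange_comp, hc, LinearMap.baseChange_zero, LinearMap.zero_apply]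

variable (i : Fin 4)

/-- the `ℂ`-linear map `ℂ ⊗ F_L → H¹(P(L, ι₁), ℂ) = ℂ ⊗ ⋀¹ L(P(L, ι₁))` placing a vector in slot `i` of block `k` -/
def slotC : (ℂ ⊗[ℚ] FK L) →ₗ[ℂ] ℂ ⊗[ℚ] ↥(⋀[ℚ]^1 (PO ι₁ d t).L) :=
  (oneEquiv ℚ (PO ι₁ d t).L).symm.toLinearMap.baseChange ℂ ∘ₗ (leafIncl ι₁ d t k).baseChange ℂ ∘ₗ
    (emb L (ΘOf L ι₁ k) i).baseChange ℂ

/-- (Ported verbatim from the HodgeCMPerL package; no docstring in the source.) -/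
lemma slotC_apply (y : ℂ ⊗[ℚ] FK L) : slotC ι₁ d t k i y
    = (PO ι₁ d t).form1 ((leafIncl ι₁ d t k).baseChange ℂ ((emb L (ΘOf L ι₁ k) i).baseChange ℂ y)) := rfl

/-- **the single eigenvector** `E_{k,i,τ'}`: `eps τ'` in slot `i` of block `k`, a vector of `ℂ ⊗ L(P(L, ι₁))` … -/
def eVec (τ' : FK L →+* ℂ) : (PO ι₁ d t).LC :=
  (leafIncl ι₁ d t k).baseChange ℂ ((emb L (ΘOf L ι₁ k) i).baseChange ℂ (eps (FK L) τ'))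

/-- … and as a degree-one class `(oneEquiv⁻¹)_ℂ E_{k,i,τ'} ∈ H¹(P(L, ι₁), ℂ)` -/
def eCls (τ' : FK L →+* ℂ) : ℂ ⊗[ℚ] ↥(⋀[ℚ]^1 (PO ι₁ d t).L) := slotC ι₁ d t k i (eps (FK L) τ')

/-- (Ported verbatim from the HodgeCMPerL package; no docstring in the source.) -/
lemma eCls_eq_form1 (τ' : FK L →+* ℂ) : eCls ι₁ d t k i τ' = (PO ι₁ d t).form1 (eVec ι₁ d t k i τ') := rfl

/-- (Ported verbatim from the HodgeCMPerL package; no docstring in the source.) -/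
lemma eVec_eq (τ' : FK L →+* ℂ) :
    eVec ι₁ d t k i τ' = (leafIncl ι₁ d t k).baseChange ℂ ((PP L (ΘOf L ι₁ k)).eB (ix L (ΘOf L ι₁ k) τ' i)) := by
  rw [eVec, emb_baseChange_eps]

variable {K : CMField} (j : K →+* L) (Ψ : CMType K)

/-- the lattice map `L(A_{(K,Ψ)}) → L(P(L, ι₁))`: `a ↦ x · j(a)` in slot `i` of block `k` -/
def leafLin (x : FK L) : (cmObj K Ψ).L →ₗ[ℚ] (PO ι₁ d t).L :=
  leafIncl ι₁ d t k ∘ₗ slotLin (ΘOf L ι₁ k) j Ψ i x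

/-- … as a morphism of generation-1 objects (Hodge because slot `(k, i)` carries the induced type) -/
def leafHom (x : FK L) (hΘ : ΘOf L ι₁ k i = indType j Ψ) : Obj.Hom (PO ι₁ d t) (cmObj K Ψ) :=
  ⟨leafLin ι₁ d t k i j Ψ x, (isHodge_leafIncl ι₁ d t k).comp (slotLin_isHodge (ΘOf L ι₁ k) j Ψ i x hΘ)⟩

/-- **the slot morphism** `m_{k,i,x} : P(L, ι₁) → A_{(K,Ψ)}` of generation-2 objects (admissible: the target is
block-free — `Obj₂.Hom₂.ofHom`) -/
def leafMor (x : FK L) (hΘ : ΘOf L ι₁ k i = indType j Ψ) :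
    Hom₂ (pbObj (pLeafOf L ι₁ d t)) (cmObj₂ K Ψ) :=
  Hom₂.ofHom (leafHom ι₁ d t k i j Ψ x hΘ) (isBlockFree_cmObj₂ K Ψ)

/-- (Ported verbatim from the HodgeCMPerL package; no docstring in the source.) -/
@[simp] lemma leafMor_lin (x : FK L) (hΘ : ΘOf L ι₁ k i = indType j Ψ) :
    (leafMor ι₁ d t k i j Ψ x hΘ).lin = leafLin ι₁ d t k i j Ψ x := rfl

/-- **the pull-back formula, core form** (universe-free): `(⋀¹ m_{k,i,x})_ℂ (gen_σ) = slotC (x · (ℂ ⊗ j)(eps σ))`;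
for each toy universe `U` on the period leaves this is `U.pullC m_{k,i,x} 1 gen_σ` by `rfl` -/
theorem map_leafLin_gen_eq_slotC (σ : K →+* ℂ) (x : FK L) :
    (map 1 (leafLin ι₁ d t k i j Ψ x)).baseChange ℂ (gen K Ψ σ)
      = slotC ι₁ d t k i ((1 ⊗ₜ[ℚ] x) * extC (jT j) (eps (FK K) (embOf K σ))) := by
  change (map 1 (leafLin ι₁ d t k i j Ψ x)).baseChange ℂ ((T K Ψ).symm (eps (FK K) (embOf K σ))) = _
  rw [T_symm_eps]
  change (map 1 (leafLin ι₁ d t k i j Ψ x)).baseChange ℂ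
      ((cmObj K Ψ).form1 ((cmObj K Ψ).eT () (embOf K σ))) = _
  rw [Obj.baseChange_map_one_form1, leafLin, LinearMap.baseChange_comp, LinearMap.comp_apply,
    slotLin_baseChange_eT, slotC_apply]

open scoped Classical in
/-- **the pull-back formula** (universe-free): `(⋀¹ m_{k,i,x})_ℂ (gen_σ) = Σ_{τ' ∘ j = σ} τ'(x) • E_{k,i,τ'}` -/
theorem map_leafLin_gen (σ : K →+* ℂ) (x : FK L) :
    (map 1 (leafLin ι₁ d t k i j Ψ x)).baseChange ℂ (gen K Ψ σ)
      = ∑ τ' ∈ Finset.univ.filter (fun τ' : FK L →+* ℂ => τ'.comp (jT j) = embOf K σ),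
          τ' x • eCls ι₁ d t k i τ' := by
  rw [map_leafLin_gen_eq_slotC, tmul_mul_extC_eps, map_sum]
  exact Finset.sum_congr rfl fun τ' _ => by rw [map_smul]; rfl


-- port_pkg: scope closed for this part
end Leaf
end
end HodgeCM.ToyG2.ThetaUiso
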